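import Literature.MathematicalPhysics.QuantumFieldTheory.Balaban1983to89.B9Thm37Whole

/-!
# `Balaban1983to89.B9Cor38Whole` — [B9] Corollary 3.8 (p. 410) AS THE WHOLE PRINTED LEAF `B9.Cor38Printed` at a PINNED
# walk reading sharing the operator letters `B9Thm37Whole.Ops` — so that ONE expansion datum carries both leaves
# `B9.Thm37Printed` (Theorem 3.7) and `B9.Cor38Printed` (Corollary 3.8)

T. Bałaban, *Propagators for lattice gauge theories in a background field*, Commun. Math. Phys. **99** (1985) 389–434
[`Balaban1985BackgroundPropagators`, "B9"]; [4] = T. Bałaban, *Propagators and renormalization transformations for lattice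
gauge theories. II*, Commun. Math. Phys. **96** (1984) 223–250 [`Balaban1984PropagatorsII`].

statement-level skeleton of published theorems with citation tags; proofs where landed; nothing here is a claim about the
Yang–Mills mass gap

THE PRINTED LOCUS (verbatim, p. 410): *"Corollary 3.8. The term in the expansion (3.90) corresponding to a walk
ω = (□₀, □₁, …, □ₙ) depends on U restricted to □̃⁵₀ ∪ □̃⁵₁ ∪ … ∪ □̃⁵ₙ, and |Δ(y)h_{□₀}G′_{□₀}h_{□₀}Π_{i=1}^n K(h_{□ᵢ})G′_{□ᵢ}
h_{□ᵢ}Δ(y′)λ| ≦ O(1)(L^jη)²O(M^{−1/2})^{|ω|}M^{−1/2|ω|}e^{−(1/2)δ₀d(ω,y,y′)}|Δ(y′)λ| (3.94) for y ∈ □₀ ∩ Λ_j, y′ ∈ □ₙ.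
Similar estimates hold for the other norms."*; (3.93): *"d(ω, y, y′) = inf_{(y₁,y₂,…,yₙ)}(d(y, y₁) + d(y₁, y₂) + … +
d(y_{n−1}, yₙ) + d(yₙ, y′)), the infimum is taken over all sequences (y₁, y₂, …, yₙ) of points yᵢ ∈ □ᵢ"*; the two
locality inputs, p. 410: *"A propagator G′_□ depends on U restricted to Ω₀(□) ⊂ □̃⁵, and the operator K(h) is
semi-local, hence a term in (3.90) corresponding to a walk ω = (□₀, □₁, …, □ₙ) depends on U restricted to
□̃⁵₀ ∪ □̃⁵₁ ∪ … ∪ □̃⁵ₙ"*.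

THE POINT.  The knit (`B9LeafKnit`, `DagBinding.B9LeafX`) reads Theorem 3.7 AND Corollary 3.8 at the SAME expansion
datum: `t37 : B9.Thm37Printed … Y.E37`, `c38 : B9.Cor38Printed … Y.E37`.  The sibling `B9Thm37Whole` inhabits `t37` at
`E37OfOps 𝔴 𝔬 R H C δ` (the convergence predicate pinned to the lineage's content; the Corollary 3.8 readings of `𝔴`
untouched — `B9Thm37Whole.cor38Printed_E37OfOps_iff`).  THIS FILE pins the Corollary 3.8 readings as well: the walks
ω = (□₀, …, □ₙ), their length |ω| = n, the end conditions, the distance d(ω, y, y′) of (3.93) (`minLen` — the printed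
infimum, certified as a lower bound of all path lengths, `B9Thm37Sum.LB`), the TERM of (3.90) read as the sup over the
block Δ(y) of |(h_{□₀}G′_{□₀}(U)h_{□₀}Π K(h_{□ᵢ})G′_{□ᵢ}(U)h_{□ᵢ} λ)(x)| (`blkSup`, with the abstract argument λ evaluated
on the site lattice by `WalkReading.ev`), and the U-LOCALISATION CLAUSE read as «the term operator at U equals the term
operator at every U′ coinciding with U on □̃⁵₀, …, □̃⁵ₙ» (`WalkReading.Agree`); the result is ONE datum
`W38OfOps 𝔬 rd R H C δ : B9.RWExpansion g B` with `E37OfOps (W38OfOps …) … = W38OfOps …` by `rfl`, at which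

* ★ `cor38Printed_of_local342` — the leaf `B9.Cor38Printed c35 geo bg (fun i => W38OfOps …)` from: Corollary 3.6
  entries 1, 2 for the G′_□(U) and the majorants of the letters of K(h_□) under the printed provisos (`Local342`,
  `Identities` of `B9Thm37Whole`, as there), the static data and the K(h_□) sizes ≦ θ₀M⁻¹ (`StaticOK`, `Sizes.Bounded`),
  [4] Lemma 2.1 (2.61) at the exponent α for M ≧ M_L, the reading clauses (`WalkReading.OK`) and the two printed
  locality inputs (`Locality`); by `B9Thm37Glue.cor38_walk_of_342` ((3.91)–(3.92) ⇒ (3.94) with the inputs `hT0`,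
  `hR` discharged from (3.42)) and `B9.split_small_factor` (the printed split (cM⁻¹)ⁿ = (cM^{−1/2})ⁿM^{−n/2});
  constants O(1) = B₀, O(M^{−1/2}) = (B₀e^{δ₀ρ}θ₀c₁(α) + 1)M^{−1/2}, rate ½δ₀′ with δ₀′ = 2(1 − α)δ₀ (α = ½ in print);
* ★ `thm37Printed_W38OfOps_of_local342` — the Theorem 3.7 leaf AT THE SAME DATUM (`B9Thm37Whole.thm37Printed_of_local342`);
* `cor38Printed_of_cor36Printed` — the Corollary 3.8 leaf from the cell's TYPED `B9.Cor36Printed` by name (constants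
  existential, as print states them), mirroring `B9Thm37Whole.thm37Printed_of_cor36Printed`.

HONEST SCOPE.  Nothing of print is asserted: Corollary 3.6 for the G′_□, the letters of K(h_□) and their sizes, (2.61),
the geometry of d, the reading clauses and the two locality inputs are HYPOTHESES of printed shape; the sup entry (3.94)
only — *"Similar estimates hold for the other norms"* is the `B9Thm37AllNorms` lineage (`cor38_left`) and is not pinned
here; walks are indexed by ℕ × (ℕ → ι) (a pair (n, ω) reads □ᵢ = ω i for i ≦ n; the printed adjacency □ᵢ ∩ □ᵢ₊₁ ≠ ∅ is not
imposed — terms of non-adjacent sequences obey the same bound); «yᵢ ∈ □ᵢ» of (3.93) is read yᵢ ∈ S′_{□ᵢ} (the blocks met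
by the coefficients of K(h_{□ᵢ})), «y ∈ □₀ ∩ Λ_j» as y ∈ S_{□₀}, «y′ ∈ □ₙ» as y′ ∈ S′_{□ₙ}.  Value: kernel-checked
bookkeeping, NOT a node discharge, NOT summit progress; nothing continuum, nothing about the mass gap.  Cell `pub-ymgap`
(HUMAN RULING D-0062), Track A node N06 [B9], seat `pub-ymgap-dag-n06-c`, 2026-08-26.
-/

namespace Literature.MathematicalPhysics.QuantumFieldTheory.Balaban1983to89.B9Cor38Whole

open Literature.MathematicalPhysics.QuantumFieldTheory.Balaban1983to89
open Finset B6RandomWalk B6RandomWalkHom B9Thm37Sum B9Thm34Ext B9Thm37Glue B9Thm37Whole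

noncomputable section

/-! ## §1 The readings: walks, the distance (3.93), the block sup, the term operators, the datum `W38OfOps` -/

section OneMember

variable {g : B9.Geometry} [Fintype g.Site] [DecidableEq g.Site] {B : B9.Backgrounds} {X Y ι : Type}

/-- **THE TWO READINGS Corollary 3.8 needs beyond the operator letters** at one member: `ev λ` = the abstract argument λ
(`g.Loc`) evaluated as a function on the site lattice `X` (the `CoRealizes` reading of `B9Thm37GlueCor36`); `Agree □ U U′`
= «the configurations U, U′ coincide on □̃⁵» (p. 410; p. 408: *"we define □̃ⁿ as a cube of the size (2 + 2n)ML^jη, and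
with the same center as □"*) — the carrier `B9.Backgrounds.Cfg` has no restriction structure, so the relation is a
datum.  A PARAMETER RECORD; nothing asserted. [cite: Balaban1985BackgroundPropagators, Cor. 3.8 p.410 + p.408] -/
structure WalkReading (g : B9.Geometry) (B : B9.Backgrounds) (X ι : Type) where
  ev : g.Loc → X → ℝ
  Agree : ι → B.Cfg → B.Cfg → Prop

/-- **The reading clauses of the evaluation** (the first three clauses of `B9Thm37GlueCor36.CoRealizes`; (3.39) ∕ (3.42)
p. 397): supp λ ⊂ Δ(y′) ⇒ `ev λ` vanishes off the block of y′; |ev λ| ≦ |λ| pointwise; |λ| ≧ 0.  A hypothesis schema.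
[cite: Balaban1985BackgroundPropagators, (3.39) + (3.42) p.397] -/
structure WalkReading.OK (rd : WalkReading g B X ι) (blk : X → g.Site) : Prop where
  off : ∀ (lam : g.Loc) (y' : g.Site), g.suppIn lam y' → ∀ x, blk x ≠ y' → rd.ev lam x = 0
  bound : ∀ (lam : g.Loc) (x : X), |rd.ev lam x| ≤ g.supNorm lam
  norm_nonneg : ∀ lam : g.Loc, 0 ≤ g.supNorm lam

/-- **THE TWO PRINTED LOCALITY INPUTS** (p. 410, verbatim: *"A propagator G′_□ depends on U restricted to Ω₀(□) ⊂ □̃⁵,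
and the operator K(h) is semi-local"*), as a hypothesis schema on the letters: the factors h_□G′_□(U)h_□ and
K(h_□)G′_□(U)h_□ = (P_□∇_U + C_□)G′_□(U)h_□ of (3.90) coincide at configurations coinciding on □̃⁵ (`Agree □`).
Nothing asserted. [cite: Balaban1985BackgroundPropagators, Cor. 3.8 p.410] -/
structure Locality (𝔬 : Ops g B X Y ι) (rd : WalkReading g B X ι) : Prop where
  gsq : ∀ (q : ι) (U U' : B.Cfg), rd.Agree q U U' →
    mulOp (𝔬.h q) * 𝔬.Gsq U q * mulOp (𝔬.h q) = mulOp (𝔬.h q) * 𝔬.Gsq U' q * mulOp (𝔬.h q)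
  kgh : ∀ (q : ι) (U U' : B.Cfg), rd.Agree q U U' →
    (𝔬.P U q ∘ₗ 𝔬.D U + 𝔬.Cop U q) * 𝔬.Gsq U q * mulOp (𝔬.h q) =
      (𝔬.P U' q ∘ₗ 𝔬.D U' + 𝔬.Cop U' q) * 𝔬.Gsq U' q * mulOp (𝔬.h q)

omit [Fintype g.Site] [DecidableEq g.Site] in
/-- **The distance d(ω, y, y′) of (3.93)** (p. 410, verbatim: *"d(ω, y, y′) = inf_{(y₁,y₂,…,yₙ)}(d(y, y₁) + d(y₁, y₂) +
… + d(y_{n−1}, yₙ) + d(yₙ, y′)), the infimum is taken over all sequences (y₁, y₂, …, yₙ) of points yᵢ ∈ □ᵢ"*), computed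
by recursion on the first intermediate point over finite candidate sets `S 1, …, S n` (S 0 is not read); when a
candidate set is empty the printed infimum is +∞ and every real is admissible — the value d(a, b) is returned.
[cite: Balaban1985BackgroundPropagators, (3.93) p.410] -/
def minLen {St : Type} (d : St → St → ℝ) : (ℕ → Finset St) → ℕ → St → St → ℝ
  | _, 0, a, b => d a b
  | S, n + 1, a, b =>
      if h : (S 1).Nonempty then (S 1).inf' h (fun z => d a z + minLen d (fun i => S (i + 1)) n z b) else d a b

omit [Fintype g.Site] [DecidableEq g.Site] in
/-- `minLen` IS an admissible lower bound of all path lengths through S 1, …, S n (`B9Thm37Sum.LB`, the defining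
property by which the lineage reads (3.93)) — indeed the largest one. [cite: Balaban1985BackgroundPropagators, (3.93) p.410] -/
theorem LB_minLen {St : Type} (d : St → St → ℝ) :
    ∀ (n : ℕ) (S : ℕ → Finset St) (a b : St), LB d S n a b (minLen d S n a b)
  | 0, _, _, _ => le_rfl
  | n + 1, S, a, b => fun z hz => by
      have hne : (S 1).Nonempty := ⟨z, hz⟩
      have hle : minLen d S (n + 1) a b ≤ d a z + minLen d (fun i => S (i + 1)) n z b := by
        simp only [minLen, dif_pos hne]
        exact Finset.inf'_le _ hz
      exact LB_mono d n (fun i => S (i + 1)) z b _ _ (LB_minLen d n (fun i => S (i + 1)) z b) (by linarith)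

omit [Fintype g.Site] [DecidableEq g.Site] in
/-- **|Δ(y)f|** — the sup of a real lattice function over the block of y (print: the sup norm restricted to Δ(y),
(3.39) ∕ (3.94)); 0 on an empty block (`Real.iSup_of_isEmpty`). [cite: Balaban1985BackgroundPropagators, (3.39) p.397 + (3.94) p.410] -/
def blkSup (blk : X → g.Site) (f : X → ℝ) (y : g.Site) : ℝ :=
  ⨆ x : {x : X // blk x = y}, f x.1

omit [Fintype g.Site] [DecidableEq g.Site] in
/-- A nonnegative pointwise bound on the block bounds the block sup (`Real.iSup_le`). [folklore] -/
private theorem blkSup_le (blk : X → g.Site) {f : X → ℝ} {y : g.Site} {c : ℝ} (hc : 0 ≤ c)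
    (h : ∀ x, blk x = y → f x ≤ c) : blkSup blk f y ≤ c :=
  Real.iSup_le (fun x => h x.1 x.2) hc

/-- **The factors of the term of (3.90) indexed by ω = (□₀, □₁, …)** at U: F₀ = h_{□₀}G′_{□₀}(U)h_{□₀},
Fᵢ = K(h_{□ᵢ})G′_{□ᵢ}(U)h_{□ᵢ} = (P_{□ᵢ}∇_U + C_{□ᵢ})G′_{□ᵢ}(U)h_{□ᵢ} (i ≧ 1); the term is `B9Thm37Sum.lprod` of these.
[cite: Balaban1985BackgroundPropagators, (3.90) p.409] -/
def walkOps (𝔬 : Ops g B X Y ι) (U : B.Cfg) (ω : ℕ → ι) (k : ℕ) : Module.End ℝ (X → ℝ) :=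
  if k = 0 then mulOp (𝔬.h (ω 0)) * 𝔬.Gsq U (ω 0) * mulOp (𝔬.h (ω 0))
  else (𝔬.P U (ω k) ∘ₗ 𝔬.D U + 𝔬.Cop U (ω k)) * 𝔬.Gsq U (ω k) * mulOp (𝔬.h (ω k))

omit [Fintype g.Site] [DecidableEq g.Site] in
/-- The supports along the walk: S_{□₀} for the first factor, S′_{□ᵢ} for the factors K(h_{□ᵢ})G′_{□ᵢ}h_{□ᵢ} — the sets
over which (3.93) takes its infimum in this reading. [cite: Balaban1985BackgroundPropagators, (3.91)–(3.93) p.410] -/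
def walkSets (𝔬 : Ops g B X Y ι) (ω : ℕ → ι) (k : ℕ) : Finset g.Site :=
  if k = 0 then 𝔬.S (ω 0) else 𝔬.S' (ω k)

omit [Fintype g.Site] [DecidableEq g.Site] in
/-- Left-nested products only read their first n + 1 factors: equal factors give equal products. [folklore] -/
private theorem lprod_congr {F F' : ℕ → Module.End ℝ (X → ℝ)} :
    ∀ (n : ℕ), (∀ k, k ≤ n → F k = F' k) → lprod F n = lprod F' n := by
  intro n
  induction n generalizing F F' with
  | zero => intro h; exact h 0 le_rfl
  | succ n ih =>
      intro h
      show F 0 * lprod (fun i => F (i + 1)) n = F' 0 * lprod (fun i => F' (i + 1)) n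
      rw [h 0 (Nat.zero_le _), ih (fun k hk => h (k + 1) (by omega))]

/-- ★ **THE EXPANSION DATUM OF THEOREM 3.7 ∕ COROLLARY 3.8 WITH EVERY FIELD PINNED.**  `Walk` = pairs (n, ω) reading the
walk (□₀, …, □ₙ) = (ω 0, …, ω n); `wlen` = |ω| = n; `first (n, ω) y` = y ∈ S_{□₀} (print: y ∈ □₀ ∩ Λ_j); `last (n, ω) y′`
= y′ ∈ S′_{□ₙ} (print: y′ ∈ □ₙ); `wdist` = d(ω, y, y′) of (3.93) (`minLen` over S′_{□₁}, …, S′_{□ₙ}); `term U (n, ω) λ y`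
= |Δ(y)h_{□₀}G′_{□₀}h_{□₀}Π_{i=1}^nK(h_{□ᵢ})G′_{□ᵢ}h_{□ᵢ}λ| read as the block sup of the lattice function
(`lprod (walkOps 𝔬 U ω) n`) applied to `ev λ`; `LocDep U (n, ω)` = «the term operator at U equals the one at every U′
coinciding with U on □̃⁵₀ ∪ … ∪ □̃⁵ₙ»; `Converges U` = `B9Thm37Whole.Conv342 𝔬 R H C δ U` (so that
`E37OfOps (W38OfOps …) … = W38OfOps …`, `E37OfOps_W38OfOps`).
[cite: Balaban1985BackgroundPropagators, Thm 3.7 (3.90) p.409 + Cor. 3.8 (3.93)–(3.94) p.410] -/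
def W38OfOps (𝔬 : Ops g B X Y ι) (rd : WalkReading g B X ι) (R : ℝ) (H : Prop) (C δ : ℝ) : B9.RWExpansion g B where
  Walk := ℕ × (ℕ → ι)
  wlen w := w.1
  first w y := y ∈ 𝔬.S (w.2 0)
  last w y' := y' ∈ 𝔬.S' (w.2 w.1)
  wdist w y y' := minLen g.dist (walkSets 𝔬 w.2) w.1 y y'
  term U w lam y := blkSup 𝔬.blk (fun x => |lprod (walkOps 𝔬 U w.2) w.1 (rd.ev lam) x|) y
  LocDep U w := ∀ U' : B.Cfg, (∀ k, k ≤ w.1 → rd.Agree (w.2 k) U U') →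
    lprod (walkOps 𝔬 U w.2) w.1 = lprod (walkOps 𝔬 U' w.2) w.1
  Converges U := Conv342 𝔬 R H C δ U

omit [DecidableEq g.Site] in
/-- Pinning the convergence predicate of `W38OfOps` changes nothing: `B9Thm37Whole.E37OfOps (W38OfOps …) … = W38OfOps …`
(by `rfl`) — the Theorem 3.7 results of `B9Thm37Whole` apply verbatim at this datum.
[cite: Balaban1985BackgroundPropagators, Thm 3.7 p.409] -/
theorem E37OfOps_W38OfOps (𝔬 : Ops g B X Y ι) (rd : WalkReading g B X ι) (R : ℝ) (H : Prop) (C δ : ℝ) :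
    E37OfOps (W38OfOps 𝔬 rd R H C δ) 𝔬 R H C δ = W38OfOps 𝔬 rd R H C δ :=
  rfl

/-! ## §2 Corollary 3.8 at one member and one configuration -/

omit [DecidableEq g.Site] in
/-- **The U-localisation clause of Corollary 3.8** (*"The term in the expansion (3.90) corresponding to a walk
ω = (□₀, □₁, …, □ₙ) depends on U restricted to □̃⁵₀ ∪ □̃⁵₁ ∪ … ∪ □̃⁵ₙ"*) at `W38OfOps`, from the two printed locality
inputs (`Locality`): p. 410, *"A propagator G′_□ depends on U restricted to Ω₀(□) ⊂ □̃⁵, and the operator K(h) is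
semi-local, hence …"*. [cite: Balaban1985BackgroundPropagators, Cor. 3.8 p.410] -/
theorem locDep_W38OfOps (𝔬 : Ops g B X Y ι) (rd : WalkReading g B X ι) (R : ℝ) (H : Prop) (C δ : ℝ)
    (hloc : Locality 𝔬 rd) (U : B.Cfg) (w : ℕ × (ℕ → ι)) : (W38OfOps 𝔬 rd R H C δ).LocDep U w := by
  intro U' hU'
  refine lprod_congr w.1 fun k hk => ?_
  by_cases hk0 : k = 0
  · subst hk0
    simp only [walkOps, if_true]
    exact hloc.gsq (w.2 0) U U' (hU' 0 (Nat.zero_le _))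
  · simp only [walkOps, hk0, if_false]
    exact hloc.kgh (w.2 k) U U' (hU' k hk)

/-- **THE BOUND (3.94) at one member and one configuration U** (p. 410: *"|Δ(y)h_{□₀}G′_{□₀}h_{□₀}Π_{i=1}^n K(h_{□ᵢ})
G′_{□ᵢ}h_{□ᵢ}Δ(y′)λ| ≦ O(1)(L^jη)²O(M^{−1/2})^{|ω|}M^{−1/2|ω|}e^{−(1/2)δ₀d(ω,y,y′)}|Δ(y′)λ| for y ∈ □₀ ∩ Λ_j"*) at the
datum `W38OfOps`, with O(1) = B₀, O(M^{−1/2}) = (B₀e^{δ₀ρ}θ₀c₁(α) + 1)M^{−1/2} and ½δ₀′, δ₀′ = 2(1 − α)δ₀: from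
Corollary 3.6 entries 1, 2 for the G′_□(U) (`Local342`), the majorants of the letters of K(h_□) (`Identities`), the
static data, the K(h_□) sizes ≦ θ₀M⁻¹ (the O(M⁻¹) of (3.89)), (2.61) at α and the reading clauses — by
`B9Thm37Glue.cor38_walk_of_342` ((3.91)–(3.92)), `LB_minLen` ((3.93)) and `B9.split_small_factor`.
[cite: Balaban1985BackgroundPropagators, Cor. 3.8 (3.91)–(3.94) p.410 + (3.89) p.409; Balaban1984PropagatorsII, Lemma 2.1 (2.61) p.234] -/
theorem term_W38OfOps_le [Fintype X] [DecidableEq X] [Fintype ι] (𝔬 : Ops g B X Y ι) (rd : WalkReading g B X ι)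
    (R : ℝ) (H : Prop) (C δ : ℝ) (d : ℕ) (δ₀ α ρ B₀ N N' Cℓ θ₀ : ℝ) (κ : Sizes) (U : B.Cfg)
    (hB₀ : 0 ≤ B₀) (hδ₀ : 0 ≤ δ₀) (hα : 0 ≤ α) (hα1 : α ≤ 1) (hθ₀ : 0 ≤ θ₀) (hM : 0 < g.M)
    (hs : StaticOK 𝔬 ρ N N' Cℓ κ) (hκ : κ.Nonneg) (hrow : κ.kP + κ.kC ≤ θ₀ * g.M⁻¹)
    (h261 : Ineq261 d (toB6 g R H) δ₀ α) (hrd : rd.OK 𝔬.blk) (hl : Local342 𝔬 R H B₀ δ₀ U)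
    (hi : Identities 𝔬 R H U) (w : ℕ × (ℕ → ι)) (lam : g.Loc) (y y' : g.Site) (hy : y ∈ 𝔬.S (w.2 0))
    (hlam : g.suppIn lam y') :
    (W38OfOps 𝔬 rd R H C δ).term U w lam y ≤
      g.len y ^ 2 * B9.walkFactor B₀ (B₀ * Real.exp (δ₀ * ρ) * θ₀ * B6.c1 d δ₀ α + 1) g.M (2 * ((1 - α) * δ₀))
        ((W38OfOps 𝔬 rd R H C δ).wlen w) ((W38OfOps 𝔬 rd R H C δ).wdist w y y') * g.supNorm lam := by
  obtain ⟨n, ω⟩ := w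
  have hlen : ∀ z : g.Site, 0 ≤ g.len z := fun z => (hs.lenpos z).le
  have htri : Triangle254 (toB6 g R H) := fun a b c => hs.tri a b c
  have hk12 : 0 ≤ κ.kP + κ.kC := add_nonneg hκ.kP hκ.kC
  have hαδ : 0 ≤ α * δ₀ := mul_nonneg hα hδ₀
  have h1αδ : 0 ≤ (1 - α) * δ₀ := mul_nonneg (by linarith) hδ₀
  have hc1 : 0 ≤ B6.c1 d δ₀ α := c1_nonneg d δ₀ α
  have hθ : 0 ≤ B₀ * Real.exp (δ₀ * ρ) * (κ.kP + κ.kC) := mul_nonneg (mul_nonneg hB₀ (Real.exp_nonneg _)) hk12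
  have hc0 : 0 ≤ B₀ * Real.exp (δ₀ * ρ) * θ₀ * B6.c1 d δ₀ α :=
    mul_nonneg (mul_nonneg (mul_nonneg hB₀ (Real.exp_nonneg _)) hθ₀) hc1
  have hcpos : 0 < B₀ * Real.exp (δ₀ * ρ) * θ₀ * B6.c1 d δ₀ α + 1 := by linarith
  -- (3.91)–(3.92): the term has the majorant 1_{S_{□₀}}(y)B₀(L^jη)²(θc₁)ⁿe^{−(1−α)δ₀dω}
  have hmaj := cor38_walk_of_342 (R := R) (H := H) 𝔬.blk 𝔬.blkY d δ₀ α ρ B₀ κ.kP κ.kC 𝔬.S 𝔬.S' 𝔬.h 𝔬.KP 𝔬.KC ω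
    (walkOps 𝔬 U ω) (walkSets 𝔬 ω) (minLen g.dist (walkSets 𝔬 ω) n) n hB₀ hδ₀ hk12 hs.dnn hαδ h1αδ htri hlen h261
    hs.hh hs.hS hs.KP_nonneg hs.KP_loc hs.KP_row hs.KC_nonneg hs.KC_loc hs.KC_row hl.e0 hl.e1 hi.hP hi.hC
    (by simp only [walkOps, if_true])
    (fun k hk _ => by
      have hk0 : k ≠ 0 := by omega
      simp only [walkOps, hk0, if_false])
    (by simp only [walkSets, if_true])
    (fun k hk _ => by
      have hk0 : k ≠ 0 := by omega
      simp only [walkSets, hk0, if_false])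
    (fun a b => LB_minLen g.dist n (walkSets 𝔬 ω) a b)
  -- evaluate at the argument λ: supp λ ⊂ Δ(y′), |ev λ| ≦ |λ|
  have hμ : BlockSupp (g := toB6 g R H) 𝔬.blk (rd.ev lam) y' (g.supNorm lam) :=
    ⟨hrd.norm_nonneg lam, fun x _ => hrd.bound lam x, hrd.off lam y' hlam⟩
  have hpt : ∀ x, 𝔬.blk x = y → |lprod (walkOps 𝔬 U ω) n (rd.ev lam) x| ≤
      B₀ * g.len y ^ 2 * ((B₀ * Real.exp (δ₀ * ρ) * (κ.kP + κ.kC)) * B6.c1 d δ₀ α) ^ n *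
        Real.exp (-((1 - α) * δ₀ * (minLen g.dist (walkSets 𝔬 ω) n y y'))) * g.supNorm lam := by
    intro x hx
    have h := hmaj y' (rd.ev lam) (g.supNorm lam) hμ x
    rw [hx] at h
    refine h.trans (le_of_eq ?_)
    simp only [if_pos hy]
  -- (θc₁)ⁿ ≦ (cM⁻¹)ⁿ = (cM^{−1/2})ⁿM^{−n/2}, θ = B₀e^{δ₀ρ}(k_P + k_C), c = B₀e^{δ₀ρ}θ₀c₁ + 1
  have hθc : (B₀ * Real.exp (δ₀ * ρ) * (κ.kP + κ.kC)) * B6.c1 d δ₀ α ≤ (B₀ * Real.exp (δ₀ * ρ) * θ₀ * B6.c1 d δ₀ α + 1) * g.M⁻¹ := by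
    have hMinv : 0 ≤ g.M⁻¹ := inv_nonneg.mpr hM.le
    have h1 : (B₀ * Real.exp (δ₀ * ρ) * (κ.kP + κ.kC)) ≤ B₀ * Real.exp (δ₀ * ρ) * (θ₀ * g.M⁻¹) :=
      mul_le_mul_of_nonneg_left hrow (mul_nonneg hB₀ (Real.exp_nonneg _))
    calc (B₀ * Real.exp (δ₀ * ρ) * (κ.kP + κ.kC)) * B6.c1 d δ₀ α
        ≤ B₀ * Real.exp (δ₀ * ρ) * (θ₀ * g.M⁻¹) * B6.c1 d δ₀ α := mul_le_mul_of_nonneg_right h1 hc1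
      _ = (B₀ * Real.exp (δ₀ * ρ) * θ₀ * B6.c1 d δ₀ α) * g.M⁻¹ := by ring
      _ ≤ (B₀ * Real.exp (δ₀ * ρ) * θ₀ * B6.c1 d δ₀ α + 1) * g.M⁻¹ := mul_le_mul_of_nonneg_right (by linarith) hMinv
  have hpow : ((B₀ * Real.exp (δ₀ * ρ) * (κ.kP + κ.kC)) * B6.c1 d δ₀ α) ^ n ≤ ((B₀ * Real.exp (δ₀ * ρ) * θ₀ * B6.c1 d δ₀ α + 1) * g.M⁻¹) ^ n :=
    pow_le_pow_left₀ (mul_nonneg hθ hc1) hθc n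
  have hexp : Real.exp (-((1 - α) * δ₀ * (minLen g.dist (walkSets 𝔬 ω) n y y'))) =
      Real.exp (-(2 * ((1 - α) * δ₀) / 2 * (minLen g.dist (walkSets 𝔬 ω) n y y'))) := by
    congr 1; ring
  have hfac : B₀ * g.len y ^ 2 * ((B₀ * Real.exp (δ₀ * ρ) * (κ.kP + κ.kC)) * B6.c1 d δ₀ α) ^ n *
        Real.exp (-((1 - α) * δ₀ * (minLen g.dist (walkSets 𝔬 ω) n y y'))) ≤
      g.len y ^ 2 * B9.walkFactor B₀ (B₀ * Real.exp (δ₀ * ρ) * θ₀ * B6.c1 d δ₀ α + 1) g.M (2 * ((1 - α) * δ₀)) n (minLen g.dist (walkSets 𝔬 ω) n y y') := by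
    calc B₀ * g.len y ^ 2 * ((B₀ * Real.exp (δ₀ * ρ) * (κ.kP + κ.kC)) * B6.c1 d δ₀ α) ^ n *
          Real.exp (-((1 - α) * δ₀ * (minLen g.dist (walkSets 𝔬 ω) n y y')))
        ≤ B₀ * g.len y ^ 2 * ((B₀ * Real.exp (δ₀ * ρ) * θ₀ * B6.c1 d δ₀ α + 1) * g.M⁻¹) ^ n *
            Real.exp (-((1 - α) * δ₀ * (minLen g.dist (walkSets 𝔬 ω) n y y'))) :=
          mul_le_mul_of_nonneg_right (mul_le_mul_of_nonneg_left hpow (mul_nonneg hB₀ (sq_nonneg _)))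
            (Real.exp_nonneg _)
      _ = g.len y ^ 2 * B9.walkFactor B₀ (B₀ * Real.exp (δ₀ * ρ) * θ₀ * B6.c1 d δ₀ α + 1) g.M (2 * ((1 - α) * δ₀)) n (minLen g.dist (walkSets 𝔬 ω) n y y') := by
          rw [B9.split_small_factor (B₀ * Real.exp (δ₀ * ρ) * θ₀ * B6.c1 d δ₀ α + 1) g.M hM n, hexp]
          simp only [B9.walkFactor]
          ring
  -- assemble: the block sup is below the (nonnegative) common bound
  have hrhs : 0 ≤ g.len y ^ 2 * B9.walkFactor B₀ (B₀ * Real.exp (δ₀ * ρ) * θ₀ * B6.c1 d δ₀ α + 1) g.M (2 * ((1 - α) * δ₀)) n (minLen g.dist (walkSets 𝔬 ω) n y y') *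
      g.supNorm lam := by
    refine mul_nonneg (mul_nonneg (sq_nonneg _) ?_) (hrd.norm_nonneg lam)
    simp only [B9.walkFactor]
    exact mul_nonneg (mul_nonneg (mul_nonneg hB₀ (pow_nonneg (mul_nonneg hcpos.le
      (Real.rpow_nonneg hM.le _)) _)) (Real.rpow_nonneg hM.le _)) (Real.exp_nonneg _)
  show blkSup 𝔬.blk (fun x => |lprod (walkOps 𝔬 U ω) n (rd.ev lam) x|) y ≤
    g.len y ^ 2 * B9.walkFactor B₀ (B₀ * Real.exp (δ₀ * ρ) * θ₀ * B6.c1 d δ₀ α + 1) g.M (2 * ((1 - α) * δ₀)) n (minLen g.dist (walkSets 𝔬 ω) n y y') * g.supNorm lam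
  refine blkSup_le 𝔬.blk hrhs fun x hx => (hpt x hx).trans ?_
  exact mul_le_mul_of_nonneg_right hfac (hrd.norm_nonneg lam)

end OneMember

/-! ## §3 The whole printed leaves at the pinned datum -/

section Family

variable {I : Type} {c35 : ℝ} {geo : I → B9.Geometry} {bg : I → B9.Backgrounds}
variable [∀ i, Fintype (geo i).Site] [∀ i, DecidableEq (geo i).Site]
variable {X Y ι : I → Type} [∀ i, Fintype (X i)] [∀ i, DecidableEq (X i)] [∀ i, Fintype (Y i)]
  [∀ i, DecidableEq (Y i)] [∀ i, Fintype (ι i)]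

omit [∀ i, Fintype (Y i)] [∀ i, DecidableEq (Y i)] in
/-- ★ **COROLLARY 3.8 AS THE WHOLE PRINTED LEAF `B9.Cor38Printed`** (p. 410: *"The term in the expansion (3.90)
corresponding to a walk ω = (□₀, □₁, …, □ₙ) depends on U restricted to □̃⁵₀ ∪ □̃⁵₁ ∪ … ∪ □̃⁵ₙ, and |Δ(y)h_{□₀}G′_{□₀}h_{□₀}
Π_{i=1}^n K(h_{□ᵢ})G′_{□ᵢ}h_{□ᵢ}Δ(y′)λ| ≦ O(1)(L^jη)²O(M^{−1/2})^{|ω|}M^{−1/2|ω|}e^{−(1/2)δ₀d(ω,y,y′)}|Δ(y′)λ| (3.94) for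
y ∈ □₀ ∩ Λ_j, y′ ∈ □ₙ"*), INHABITED at the pinned datum `W38OfOps (𝔬 i) (rd i) (R i) (H i) C δ` — from, per member
and per U under the provisos of Corollary 3.6 (M ≧ M₁, 0 < α₀, O(1)Mα₀ ≦ a₁, (3.35)): Corollary 3.6 for the G′_□(U)
(`Local342`) and the letters of the expansion (`Identities`); per member: the static data (`StaticOK`), the sizes
(`Sizes.Bounded`: K(h_□) sizes ≦ θ₀M⁻¹), (2.61) at α for M ≧ M_L, the reading clauses (`WalkReading.OK`) and the two
printed locality inputs (`Locality`).  Quantifiers met with M₂ := max(M₁, M_L), a₀ := a₁∕O(1), δ₀′ := 2(1 − α)δ₀,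
O(1) := B₀, c := B₀e^{δ₀ρ}θ₀c₁(α) + 1.  Nothing of print asserted; the sup entry (3.94) only (*"Similar estimates hold
for the other norms"* = `B9Thm37AllNorms.cor38_left`, not pinned here); NOT a node discharge.
[cite: Balaban1985BackgroundPropagators, Cor. 3.8 (3.93)–(3.94) p.410 + Cor. 3.6 p.408; Balaban1984PropagatorsII, Lemma 2.1 (2.61) p.234] -/
theorem cor38Printed_of_local342 (𝔬 : ∀ i, Ops (geo i) (bg i) (X i) (Y i) (ι i))
    (rd : ∀ i, WalkReading (geo i) (bg i) (X i) (ι i)) (R : I → ℝ) (H : I → Prop) (κ : I → Sizes) (C δ : ℝ)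
    (d : ℕ) (α ρ N N' Cℓ K θ₀ B₀ δ₀ a₁ M₁ ML : ℝ)
    (hc : 0 < c35) (hα : 0 ≤ α) (hα1 : α < 1) (hθ₀ : 0 ≤ θ₀) (hB₀ : 0 < B₀) (hδ₀ : 0 < δ₀) (ha₁ : 0 < a₁)
    (hM₁ : 0 < M₁)
    (hst : ∀ i, StaticOK (𝔬 i) ρ N N' Cℓ (κ i)) (hκ : ∀ i, (κ i).Bounded K θ₀ Cℓ (geo i).M)
    (hrd : ∀ i, (rd i).OK (𝔬 i).blk) (hloc : ∀ i, Locality (𝔬 i) (rd i))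
    (h261 : ∀ i, ML ≤ (geo i).M → Ineq261 d (toB6 (geo i) (R i) (H i)) δ₀ α)
    (h36 : ∀ i, M₁ ≤ (geo i).M → ∀ α₀ : ℝ, 0 < α₀ → c35 * (geo i).M * α₀ ≤ a₁ →
      ∀ U : (bg i).Cfg, (bg i).Reg335 c35 α₀ U →
        Local342 (𝔬 i) (R i) (H i) B₀ δ₀ U ∧ Identities (𝔬 i) (R i) (H i) U) :
    B9.Cor38Printed c35 geo bg (fun i => W38OfOps (𝔬 i) (rd i) (R i) (H i) C δ) := by
  have hcpos : 0 < B₀ * Real.exp (δ₀ * ρ) * θ₀ * B6.c1 d δ₀ α + 1 := by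
    have h0 : 0 ≤ B₀ * Real.exp (δ₀ * ρ) * θ₀ * B6.c1 d δ₀ α :=
      mul_nonneg (mul_nonneg (mul_nonneg hB₀.le (Real.exp_nonneg _)) hθ₀) (c1_nonneg d δ₀ α)
    linarith
  refine ⟨max M₁ ML, a₁ / c35, 2 * ((1 - α) * δ₀), B₀, B₀ * Real.exp (δ₀ * ρ) * θ₀ * B6.c1 d δ₀ α + 1,
    lt_max_of_lt_left hM₁, div_pos ha₁ hc, by nlinarith, hB₀, hcpos, ?_⟩
  intro i hM α₀ hα₀ hMa U hU w lam y y' hfirst _hlast hlam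
  have hM₁i : M₁ ≤ (geo i).M := le_trans (le_max_left _ _) hM
  have hMLi : ML ≤ (geo i).M := le_trans (le_max_right _ _) hM
  have hMpos : 0 < (geo i).M := lt_of_lt_of_le hM₁ hM₁i
  have ha : c35 * (geo i).M * α₀ ≤ a₁ := by
    have h1 : (geo i).M * α₀ * c35 ≤ a₁ := (le_div_iff₀ hc).mp hMa
    calc c35 * (geo i).M * α₀ = (geo i).M * α₀ * c35 := by ring
      _ ≤ a₁ := h1
  obtain ⟨hl, hi⟩ := h36 i hM₁i α₀ hα₀ ha U hU
  exact ⟨locDep_W38OfOps (𝔬 i) (rd i) (R i) (H i) C δ (hloc i) U w,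
    term_W38OfOps_le (𝔬 i) (rd i) (R i) (H i) C δ d δ₀ α ρ B₀ N N' Cℓ θ₀ (κ i) U hB₀.le hδ₀.le hα hα1.le hθ₀
      hMpos (hst i) (hκ i).nonneg (hκ i).row (h261 i hMLi) (hrd i) hl hi w lam y y' hfirst hlam⟩

/-- ★ **THEOREM 3.7 AS THE WHOLE PRINTED LEAF AT THE SAME DATUM** — `B9Thm37Whole.thm37Printed_of_local342` read at
`W38OfOps` (`E37OfOps (W38OfOps …) … = W38OfOps …` by `rfl`): one expansion datum carries BOTH knit fields `t37` and
`c38`.  Hypotheses as there. [cite: Balaban1985BackgroundPropagators, Thm 3.7 (3.90) pp.409–410] -/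
theorem thm37Printed_W38OfOps_of_local342 (𝔬 : ∀ i, Ops (geo i) (bg i) (X i) (Y i) (ι i))
    (rd : ∀ i, WalkReading (geo i) (bg i) (X i) (ι i)) (R : I → ℝ) (H : I → Prop) (κ : I → Sizes) (d : ℕ)
    (α ρ N N' Cℓ K θ₀ B₀ δ₀ a₁ M₁ ML : ℝ)
    (hc : 0 < c35) (hα : 0 ≤ α) (hα2 : α ≤ 1 / 2) (hN : 0 ≤ N) (hN' : 0 ≤ N') (hCℓ : 1 ≤ Cℓ) (hK : 0 ≤ K)
    (hB₀ : 0 ≤ B₀) (hδ₀ : 0 ≤ δ₀) (ha₁ : 0 < a₁) (hM₁ : 0 < M₁)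
    (hst : ∀ i, StaticOK (𝔬 i) ρ N N' Cℓ (κ i)) (hκ : ∀ i, (κ i).Bounded K θ₀ Cℓ (geo i).M)
    (h261 : ∀ i, ML ≤ (geo i).M → Ineq261 d (toB6 (geo i) (R i) (H i)) δ₀ α)
    (h36 : ∀ i, M₁ ≤ (geo i).M → ∀ α₀ : ℝ, 0 < α₀ → c35 * (geo i).M * α₀ ≤ a₁ →
      ∀ U : (bg i).Cfg, (bg i).Reg335 c35 α₀ U →
        Local342 (𝔬 i) (R i) (H i) B₀ δ₀ U ∧ Identities (𝔬 i) (R i) (H i) U) :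
    B9.Thm37Printed c35 geo bg
      (fun i => W38OfOps (𝔬 i) (rd i) (R i) (H i) (const37 d δ₀ α ρ B₀ N N' Cℓ K) ((1 - 2 * α) * δ₀)) :=
  thm37Printed_of_local342
    (fun i => W38OfOps (𝔬 i) (rd i) (R i) (H i) (const37 d δ₀ α ρ B₀ N N' Cℓ K) ((1 - 2 * α) * δ₀))
    𝔬 R H κ d α ρ N N' Cℓ K θ₀ B₀ δ₀ a₁ M₁ ML hc hα hα2 hN hN' hCℓ hK hB₀ hδ₀ ha₁ hM₁ hst hκ h261 h36

/-- **Corollary 3.8 as the whole printed leaf, FROM THE CELL'S TYPED COROLLARY 3.6 BY NAME** (mirror of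
`B9Thm37Whole.thm37Printed_of_cor36Printed`): `B9.Cor36Printed` over the Σ-family of the local sequences {Ω_n(□)} with
the `B9SectCDiffDict.Realizes` readings of the four words of G′_□(U) (`B9Thm37Whole.local342_of_cor36Printed`), the
letters of the expansion at the (3.35)-regular configurations, the static data, sizes, readings, locality inputs and
[4] Lemma 2.1 (2.61) in its «RM sufficiently large» form give `B9.Cor38Printed c35 geo bg (fun i => W38OfOps … C δ)`
(Corollary 3.6's constants B₀, δ₀ consumed inside; C, δ arbitrary — Corollary 3.8 does not read the convergence
predicate).  Nothing of print asserted. [cite: Balaban1985BackgroundPropagators, Cor. 3.8 p.410 + Cor. 3.6 p.408; Balaban1984PropagatorsII, Lemma 2.1 (2.59)–(2.61) pp.233–234] -/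
theorem cor38Printed_of_cor36Printed {d : ℕ} (𝔬 : ∀ i, Ops (geo i) (bg i) (X i) (Y i) (ι i))
    (rd : ∀ i, WalkReading (geo i) (bg i) (X i) (ι i)) (R : I → ℝ) (H : I → Prop) (κ : I → Sizes) (C δ : ℝ)
    (α ρ N N' Cℓ K θ₀ : ℝ) {InCube : (Σ i, ι i) → Prop}
    {GpL GAL : ∀ p : (Σ i, ι i), B9.KernelFamily (geo p.1) (bg p.1)}
    {CinvL : ∀ p : (Σ i, ι i), B9.SiteKernel (geo p.1) (bg p.1)}
    (hc : 0 < c35) (hα : 0 ≤ α) (hα1 : α < 1) (hθ₀ : 0 ≤ θ₀)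
    (hst : ∀ i, StaticOK (𝔬 i) ρ N N' Cℓ (κ i)) (hκ : ∀ i, (κ i).Bounded K θ₀ Cℓ (geo i).M)
    (hrd : ∀ i, (rd i).OK (𝔬 i).blk) (hloc : ∀ i, Locality (𝔬 i) (rd i))
    (hL21 : ∀ δ₀ : ℝ, 0 < δ₀ → ∃ ML : ℝ, ∀ i, ML ≤ (geo i).M → Ineq261 d (toB6 (geo i) (R i) (H i)) δ₀ α)
    (h36 : B9.Cor36Printed d c35 (fun p : (Σ i, ι i) => geo p.1) (fun p => bg p.1) InCube GpL GAL CinvL)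
    (hIn : ∀ i (q : ι i), InCube ⟨i, q⟩)
    (hR0 : ∀ i (q : ι i) (U : (bg i).Cfg),
      B9SectCDiffDict.Realizes (GpL ⟨i, q⟩) 0 U (𝔬 i).blk (𝔬 i).blk (LinearMap.toMatrix' ((𝔬 i).Gsq U q)))
    (hR1 : ∀ i (q : ι i) (U : (bg i).Cfg),
      B9SectCDiffDict.Realizes (GpL ⟨i, q⟩) 1 U (𝔬 i).blkY (𝔬 i).blk
        (LinearMap.toMatrix' ((𝔬 i).D U ∘ₗ (𝔬 i).Gsq U q)))
    (hR2 : ∀ i (q : ι i) (U : (bg i).Cfg),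
      B9SectCDiffDict.Realizes (GpL ⟨i, q⟩) 2 U (𝔬 i).blk (𝔬 i).blkY
        (LinearMap.toMatrix' ((𝔬 i).Gsq U q ∘ₗ (𝔬 i).Dstar U)))
    (hR3 : ∀ i (q : ι i) (U : (bg i).Cfg),
      B9SectCDiffDict.Realizes (GpL ⟨i, q⟩) 3 U (𝔬 i).blk (𝔬 i).blk
        (LinearMap.toMatrix' ((𝔬 i).Lap U ∘ₗ (𝔬 i).Gsq U q)))
    (hid : ∀ i (α₀ : ℝ) (U : (bg i).Cfg), 0 < α₀ → (bg i).Reg335 c35 α₀ U → Identities (𝔬 i) (R i) (H i) U) :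
    B9.Cor38Printed c35 geo bg (fun i => W38OfOps (𝔬 i) (rd i) (R i) (H i) C δ) := by
  have hlen : ∀ i (y : (geo i).Site), 0 ≤ (geo i).len y := fun i y => ((hst i).lenpos y).le
  obtain ⟨a₁, M₁, B₀, δ₀, ha₁, hM₁, hB₀, hδ₀, hl⟩ :=
    local342_of_cor36Printed 𝔬 R H h36 hIn hlen hR0 hR1 hR2 hR3
  obtain ⟨ML, h261⟩ := hL21 δ₀ hδ₀
  exact cor38Printed_of_local342 𝔬 rd R H κ C δ d α ρ N N' Cℓ K θ₀ B₀ δ₀ a₁ M₁ ML hc hα hα1 hθ₀ hB₀ hδ₀ ha₁ hM₁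
    hst hκ hrd hloc h261 (fun i hM α₀ hα₀ ha U hU => ⟨hl i hM α₀ hα₀ ha U hU, hid i α₀ U hα₀ hU⟩)

end Family

end

end Literature.MathematicalPhysics.QuantumFieldTheory.Balaban1983to89.B9Cor38Whole
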